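import Summits.QuantumFields.YangMills.Theorems.IR.TensionStrongCoupling
import Summits.QuantumFields.YangMills.Theorems.IR.TorusWilsonLoopRepOddPlaquetteBound
import Summits.QuantumFields.YangMills.Theorems.IR.TensionRatioSelf
import Summits.QuantumFields.YangMills.Theorems.IR.TensionRatioPlaquetteFloor
import HarnessLib

/-!
# Line `tension-ratio` for crux `IR` (stmt-QuantumFields-19354) — ideator ym-ir-idea-7 g0/g2; skeleton v1.8 (EVERY RUNG PROVED: input `PlaquetteFloorSC` is a tree theorem, hence T2-sc `RatioStrongCoupling` and T2-sc-window hold for every centre-charged π; sorries = the 4 loads only)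
# (technique lens: large-N ∕ reduced models as CALIBRATION only)

v1.8 (pooled prover ym-ir-line-pool-p3 g3, 2026-08-28T07Z): the input `PlaquetteFloorSC` (Defs §7) is PROVED in the tree —
`Theorems/IR/TensionRatioPlaquetteFloor.lean`: `plaquetteFloorSC_holds` (volume-uniform strong-coupling floor `wβ^k ≤ ⟨χ_π(U_p)⟩` for EVERY
continuous `π` of positive size under EVERY faithful unitary continuous action `r.ρ`, every compact `G`; parts `TensionRatioPlaquetteFloor{Projection,
Order,TorusPeel,TorusExpansion,TorusNumerator}`: Haar-average idempotents `P_t` of signed tensor representations with `tr P_t ∈ ℕ`, ORDER `k` of the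
single-link integrals by real Stone–Weierstrass on `{Re tr(ρ g M)}`, one-bond PEELING of strong-coupling monomials on the torus, numerator to order `k`,
and `∫e^{−βS} ≤ ∫e^{−βS_B}` as the whole volume-uniformity — no cluster expansion).  Hence `loopFloorSC_holds`, `ratioStrongCoupling_holds :
RatioStrongCoupling`, `ratioStrongCouplingWindow_holds` are tree theorems and the stubs `stub_input_plaquetteFloorSC`, `stub_input_loopFloorSC`,
`stub_rung_ratioStrongCoupling`, `stub_rung_ratioStrongCouplingWindow` below carry NO `sorry`.  Sorries now: exactly the 4 LOADS (`stub_tensionFloor`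
T1 XL, `stub_ratioFloor` T2 XL, residuals `stub_irCentreFree`, `stub_irNSC`).  Registry NOT re-run by this seat (g9-№1: a LEAD's call).  HONEST: format
rungs inside `IR`'s known strong-coupling regime; nothing here proves confinement at weak coupling, `IR`, or the YM mass gap (Clay).

v1.7 (pooled prover ym-ir-line-pool-p3 g2, 2026-08-28T04:10Z): the odd-torus reflection-positivity chain for loops in an ARBITRARY representation `π`
is now in the tree (`Theorems/IR/TorusWilsonLoopRepOddGramBounds.lean` p603554: Gram inequalities for `π`-loops on ODD tori;
`Theorems/IR/TorusWilsonLoopRepOddPlaquetteBound.lean` p603904: Seiler–Bachas `⟨W^π_{1×1}⟩^{hR} ≤ ⟨W^π_{h×R}⟩` on odd tori + `loopFloorSC_of_plaquetteFloorSC`),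
so the input `LoopFloorSC` REDUCES to the `π`-PLAQUETTE FLOOR `PlaquetteFloorSC` (Defs §7, p603603: `wβ^k ≤ ⟨χ_π(U_p)⟩_{2S+1,β}` on large odd tori,
`β ∈ (0, βP]` — the volume-uniform leading order of the strong-coupling expansion of ONE local observable; TRUE, in the tree only for `π = r.ρ`
special unitary).  For `π = r.ρ` special unitary the body of T2-sc is PROVED outright on the line's odd tori: `ratioStrongCoupling_specialUnitary`
(`Theorems/IR/TensionRatioSelf.lean`, p603055; odd-torus Seiler–Bachas for `ρ`-loops p602802 + plaquette floor + input (a)).  Sorries: 4 line stubs +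
1 input stub `stub_input_plaquetteFloorSC` = 5; `stub_input_loopFloorSC`, both rung stubs and all RP rungs carry no `sorry` of their own.  Registry NOT re-run.

v1.6 (pooled prover ym-ir-line-pool-p3 g2, 2026-08-28T03:30Z): INPUT (a) of the card's v1.6 note is a TREE THEOREM —
`StrongCouplingRate.coldPressureBound_strongCoupling_log` (`Theorems/IR/StrongCouplingRateColdPressure.lean`, p600923; prequel
`StrongCouplingRateTail.lean` p600198: the Kotecký–Preiss tail with decay weight `τ·#Y`): `ColdPressureBound r.ρ β S ((1 + log(r_ρ/β))/8) C₀` on EVERY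
torus for `0 < β ≤ r_ρ = strongCouplingRadius r.ρ`, ONE absolute `C₀` (also `transferGap_strongCoupling_rate`: volume-uniform lattice gap `≥ (1 + log(r_ρ/β))/4`).
Consequences typed and proved in the tree: (i) `RatioStrongCouplingRP` (Defs §5, p600778) — the `(0, β_D]`-UNIFORM ratio constant for the special-unitary
model on even tori — PROVED, `ratioStrongCouplingRP_holds` (`Theorems/IR/TensionRatioRP.lean`, p601323; RP p592927 + plaquette floor + input (a)); (ii) the
registered rungs T2-sc AND T2-sc-window are REDUCED to ONE typed input `LoopFloorSC` (Defs §6, p601563: the odd-torus strong-coupling loop floor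
`(wβ^k)^{n²} ≤ |⟨χ_π(W_{n×n})⟩_{2S+1}|`, i.e. input (b): Seiler's a-priori lower bound ∕ OS78 §5 on the line's ODD tori for a general centre-charged `π` —
not in the tree: even-torus RP only, π-plaquette floor only for the fundamental) by `ratioStrongCoupling_of_loopFloorSC` ∕
`ratioStrongCouplingWindow_of_loopFloorSC` (`Theorems/IR/TensionRatioOfLoopFloor.lean`).  Below, both rung stubs are closed MODULO the new input stub
`stub_input_loopFloorSC` (no `sorry` of their own).  Sorries now: 4 line stubs + 1 input stub (LF) = 5.  Registry NOT re-run by this seat.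

v1.5 (pooled prover ym-ir-line-pool-p3, 2026-08-28T02Z): the window-rung statements `RatioStrongCouplingWindow`,
`ratioStrongCouplingWindow_of_ratioStrongCoupling`, `RatioStrongCouplingWindowRP` of v1.3/v1.4 are now TREE CONSTANTS (§4 of
`Theorems/IR/TensionRatioDefs.lean`, p595112, statements VERBATIM 04e7cc7efbc5) and are removed from this file; RUNG T2-sc-window-RP is PROVED in the
tree: `Theorems/IR/TensionRatioWindowRP.lean` — `ratioStrongCouplingWindowRP_holds : RatioStrongCouplingWindowRP` (plaquette floor
`PlaquetteLowerBound.wilsonExpectation_plaquette_ge` + torus RP bound p592927 + `coldPressureAt_strongCoupling`, rate cap `s ≤ −log(c_pl β₁)`);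
the stub below is closed by it (no `sorry`).  Sorries now: 4 line stubs + 2 open rung stubs (T2-sc, T2-sc-window).

v1.2 (pooled prover ym-ir-line-pool-p3, 2026-08-28): the line's vocabulary (`torusRect`, `TorusAreaLaw`, `TensionFloor`,
`RatioFloorSC`, `IRscCentreFree`, rungs `TensionStrongCoupling`, `RatioStrongCoupling`) and its PROVED seams
(`coldPressureBound_mono_rate`, `gapInUnits_of_rate_in_units`, `irsc_of_tension_ratio`, `ir_of_tension_ratio`) are now TREE CONSTANTS in
`Summits/QuantumFields/YangMills/Theorems/IR/TensionRatioDefs.lean` (p589073, statements VERBATIM from v1.1 2db9695cba9c); this file keeps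
only the registered stubs (same names, same signatures — now literally the tree constants) and the composition `IR_of`.
RUNG T1-sc is PROVED in the tree: `Theorems/IR/TensionStrongCoupling.lean` (p590163) —
`stub_rung_tensionStrongCoupling_proved : TensionStrongCoupling` (torus Osterwalder–Seiler area law at strong coupling for
centre-charged loops, every compact `G`; the tree's `LatticeGaugeTorusAreaLaw` with `SU(N)` replaced by the centre-charged hypotheses);
the stub below is closed by it (no `sorry`).  RUNG T2-sc stays OPEN: as typed it needs TWO strong-coupling facts the tree lacks — a
volume-uniform transfer gap at RATE `≳ ln(1/β)` (tree: rate 1/8, `ColdPressurePincer.coldPressureAt_strongCoupling`) and Seiler's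
RP lower bound on Wilson loops (`V(R) ≤ σ_max(β) R`, Phys. Rev. D 18 (1978) 482; Montvay–Münster p.151) bounding the admissible `s`.

v1.3 (ideator g2, 2026-08-28; answers pool-p3 00:42Z and ym-ir-lit-4 00:56Z): the LANDABLE strong-coupling rung is the WINDOW form
`RatioStrongCouplingWindow` (§1b): the ratio format on a compact window `[β₁, βD]` with the constant `c = c(β₁)` allowed to shrink with the
window — exactly the shape of `RatioFloorSC` (`∃ c` uniform on the β-range in force) transplanted to a compact strong-coupling range.  Why the
window: with `r` faithful the `π`-plaquette expectation is `≍ β^k` (`k = k(ρ,π)`), so by the torus Seiler/Bachas lower bound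
`W_π(1,1)^{RT} ≤ W_π(R,T)` an area law `(C,s)` on all large tori forces `s ≤ s_max(β) ≍ k·ln(1/β) → ∞` as `β → 0`; the tree's volume-uniform
strong-coupling cold pressure has the β-INDEPENDENT rate `1/8` (`coldPressureAt_strongCoupling`), so a window-uniform `c` exists
(`c(β₁) = 1/(8√(s_max(β₁)))`), while the `(0, βD]`-uniform `c` of `RatioStrongCoupling` needs the optimal rate `m(β) = 4 ln(1/β) − O(1)`
(Montvay–Münster (3.438)), not in the tree.  `RatioStrongCoupling → RatioStrongCouplingWindow` is proved below (the window rung is WEAKER);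
both rung stubs stay registered; neither is consumed by `IR_of`.

v1.4 (ideator g2, 2026-08-28 ~01:40Z; consumes ym-ir-lit-4's deliveries of 01:18Z/01:19Z): §1c adds the rung INSTANCE that is landable with NO new
Literature — `RatioStrongCouplingWindowRP`: the window shape for the action's own special-unitary fundamental model (`IsSpecialUnitaryModel r.ρ`,
`2 ≤ r.N`; `π := r.ρ` is centre-charged for `SU(N)`) with the area-law hypothesis read on EVEN tori in the `wilsonExpectation ∕ wilsonLoop`
vocabulary of `Literature/…/TorusWilsonLoopRepGramBounds.lean` (p592927, reflection positivity needs an even side; our cold-pressure currency lives on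
the odd tori `2S+1`, and in the window rung the area law's ONLY job is to cap the rate `s`, so the parity of the tori carrying the hypothesis is
immaterial).  Inputs, all in the tree: (i) `plaquette_pow_le_wilsonExpectation_wilsonLoopRep` (`⟨W₁ₓ₁⟩^{hR} ≤ ⟨W_{h×R}⟩`, even `L`, p592927),
(ii) `wilsonExpectation_plaquette_ge` (LatticeGaugePlaquetteLowerBound.lean:868; volume-uniform plaquette floor `w(β) > 0` on `(0, β₂]` for
special-unitary models, both parities), (iii) `ColdPressurePincer.coldPressureAt_strongCoupling` (rate `1/8`) + `coldPressureBound_mono_rate`;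
recipe: `w_min := min_{[β₁,βD]} w > 0` (concave floor ⇒ endpoint minimum), `R = T = n`, `L = 2n → ∞` gives `s ≤ ln(1/w_min)`, then
`c(β₁) := 1/(8√(ln(1/w_min)))` (`w_min = 1` ⇒ `s ≤ 0`, hypothesis set empty).  Size M–L, one prover session.  The general centre-charged `π ≠ ρ`
window rung (§1b) still needs the small-β positivity `⟨W^π₁ₓ₁⟩ ≍ β^k` (cluster expansion, not RP).

LEVER: the dimensionless mass ∕ string-tension RATIO FLOOR `m ≥ c·√σ` (`RatioFloorSC`, scale-free) composed with confinement IN UNITS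
along the trajectory (`TensionFloor`, centre-charged loops, simply-connected simple `G` with non-trivial centre); residuals `IRscCentreFree`
(G₂, F₄, E₈) and `IRnsc` (π₁ ≠ 1) declared; strong-coupling FORMAT rungs `TensionStrongCoupling` (torus OS78 area law) and
`RatioStrongCoupling` typed, not consumed by `IR_of`.

HONEST FRAMING: a kernel-checked CONDITIONAL reduction of ONE binder (`IR`, rung R2c) of a CONDITIONAL chain; `TensionFloor` is the
confinement problem in units (OPEN since Wilson 1974 beyond strong coupling), `RatioFloorSC` is an unprinted bridge obligation; two residual
halves are carried OPEN; the YM mass gap (Clay) is NOT proved by any of this; R4 closes only the conditional finite-𝕋⁴ rung `BalabanLadder.UV`.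
Sorries ONLY inside `stub_*` (v1.7: 4 line stubs + 1 input stub `stub_input_plaquetteFloorSC`; rungs T1-sc, T2-sc-window-RP, T2-sc-RP closed; T2-sc at
`π = r.ρ` special unitary PROVED (`ratioStrongCoupling_specialUnitary`); rungs T2-sc, T2-sc-window closed modulo the input stub).
-/

set_option autoImplicit false

noncomputable section

open Filter Topology MeasureTheory
open Literature.MathematicalPhysics.QuantumFieldTheory Literature.MathematicalPhysics.QuantumLattice
open Literature.MathematicalPhysics.QuantumFieldTheory.Balaban1983to89.Sufficient (ColdPressureBound)
open Summit.QuantumFields.YangMills.Cruxes.IR.ColdPressurePincer (IRnsc)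

namespace Summit.QuantumFields.YangMills.Cruxes.IR.TensionRatio

/-! ## §1 Registered stubs (statements are the tree constants of `Theorems/IR/TensionRatioDefs.lean`) -/

/-- stub **T1** (confinement in units; the known wall, met by the centre ∕ flux technique family, not by clustering). -/
theorem stub_tensionFloor : TensionFloor := by
  sorry

/-- stub **T2** (the ratio floor; the unprinted converse bridge «area law ⇒ gap» in scale-free form). -/
theorem stub_ratioFloor : RatioFloorSC := by
  sorry

/-- stub **R_CF** (RESIDUAL: centre-free simply-connected simple `G`). -/
theorem stub_irCentreFree : IRscCentreFree := by
  sorry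

/-- stub **R_NSC** (RESIDUAL: the flux-sector half `π₁(G) ≠ 1`, tree constant `ColdPressurePincer.IRnsc`). -/
theorem stub_irNSC : IRnsc := by
  sorry

/-- rung stub **T1-sc** (strong-coupling instance of the `TorusAreaLaw` format; not consumed by `IR_of`) — PROVED in the tree
(`Theorems/IR/TensionStrongCoupling.lean`, p590163). -/
theorem stub_rung_tensionStrongCoupling : TensionStrongCoupling :=
  stub_rung_tensionStrongCoupling_proved

/-- input stub **PF** (v1.7; v1.8: PROVED in the tree, `plaquetteFloorSC_holds`) — the strong-coupling `π`-PLAQUETTE FLOOR on odd tori (`TensionRatioDefs` §7, p603603): `wβ^k ≤ ⟨χ_π(U_p)⟩_{2S+1,β}` on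
all large odd tori for `β ∈ (0, βP]` — the ONE remaining input of the rungs T2-sc ∕ T2-sc-window (volume-uniform leading order of the strong-coupling
expansion of one local observable; TRUE — `c_{k_π} = E_Haar[χ_π (Re tr r.ρ)^{k_π}]/k_π! > 0` — in the tree only for `π = r.ρ` special unitary,
`PlaquetteLowerBound.wilsonExpectation_plaquette_ge`; general `π`: order-`k_π` surface expansion, size L–XL). -/
theorem stub_input_plaquetteFloorSC : PlaquetteFloorSC :=
  PlaquetteFloor.plaquetteFloorSC_holds

/-- input **LF** (v1.6: the loop floor on odd tori, `TensionRatioDefs` §6) — v1.7: closed MODULO `stub_input_plaquetteFloorSC` by the landed odd-torus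
reflection-positivity chain for `π`-loops (`loopFloorSC_of_plaquetteFloorSC`, p603904). -/
theorem stub_input_loopFloorSC : LoopFloorSC :=
  loopFloorSC_of_plaquetteFloorSC stub_input_plaquetteFloorSC

/-- rung stub **T2-sc** (strong-coupling instance of the ratio format; not consumed by `IR_of`) — v1.6: closed MODULO `stub_input_loopFloorSC` by the
landed reduction `ratioStrongCoupling_of_loopFloorSC` (`Theorems/IR/TensionRatioOfLoopFloor.lean`; input (a) = tree theorem
`StrongCouplingRate.coldPressureBound_strongCoupling_log`, p600923). -/
theorem stub_rung_ratioStrongCoupling : RatioStrongCoupling :=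
  ratioStrongCoupling_of_loopFloorSC stub_input_loopFloorSC

/-! ## §1b (v1.3) The landable window rung T2-sc-window -/

-- `RatioStrongCouplingWindow`, `ratioStrongCouplingWindow_of_ratioStrongCoupling`: tree constants (TensionRatioDefs §4, p595112).

/-- rung stub **T2-sc-window** (v1.3; general centre-charged `π`) — v1.6: closed MODULO `stub_input_loopFloorSC`
(`ratioStrongCouplingWindow_of_loopFloorSC`; its special-unitary instances §1c/§1d are PROVED in the tree). -/
theorem stub_rung_ratioStrongCouplingWindow : RatioStrongCouplingWindow :=
  ratioStrongCouplingWindow_of_loopFloorSC stub_input_loopFloorSC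

/-! ## §1c (v1.4) The rung instance landable from the tree alone: T2-sc-window-RP -/

-- `RatioStrongCouplingWindowRP`: tree constant (TensionRatioDefs §4, p595112).

/-- rung stub **T2-sc-window-RP** (v1.4) — PROVED in the tree (`Theorems/IR/TensionRatioWindowRP.lean`, v1.5). -/
theorem stub_rung_ratioStrongCouplingWindowRP : RatioStrongCouplingWindowRP :=
  ratioStrongCouplingWindowRP_holds

/-! ## §1d (v1.6) The `(0, β_D]`-UNIFORM rung for the special-unitary model: T2-sc-RP (PROVED) -/

-- `RatioStrongCouplingRP`: tree constant (TensionRatioDefs §5, p600778); `RatioStrongCouplingRP → RatioStrongCouplingWindowRP` is the tree's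
-- `ratioStrongCouplingWindowRP_of_ratioStrongCouplingRP`.

/-- rung **T2-sc-RP** (v1.6) — ONE ratio constant `c` on ALL of `(0, β_D]` (the quantifier shape of T2-sc) for the special-unitary model on even tori;
PROVED in the tree (`Theorems/IR/TensionRatioRP.lean`, p601323: RP p592927 + plaquette floor + input (a)). -/
theorem stub_rung_ratioStrongCouplingRP : RatioStrongCouplingRP :=
  ratioStrongCouplingRP_holds

/-! ## §1e (v1.7) T2-sc at `π = r.ρ`, special-unitary model: PROVED on the line's odd tori (no input stub) -/

/-- (v1.7) The body of `RatioStrongCoupling` at the canonical centre-charged loop `π = r.ρ` of a special-unitary model is the tree theorem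
`ratioStrongCoupling_specialUnitary` (p603055) — recorded here as an `example` so the skeleton documents what is unconditional. -/
example (G : Type) [Group G] [TopologicalSpace G] [IsTopologicalGroup G] [CompactSpace G] [MeasurableSpace G] [BorelSpace G]
    (r : LatticeRep G) (hSU : IsSpecialUnitaryModel r.ρ) (hN2 : 2 ≤ r.N) :
    ∃ c : ℝ, 0 < c ∧ ∃ βD : ℝ, 0 < βD ∧ ∀ β : ℝ, 0 < β → β ≤ βD → ∀ s : ℝ, 0 < s → ∀ C : ℝ,
      (∃ S₂ : ℕ, ∀ S : ℕ, S₂ ≤ S → TorusAreaLaw r.ρ (fun g => normalisedCharacter r.N (r.ρ g)) β S C s) →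
        ∃ C₀ : ℝ, 0 ≤ C₀ ∧ ∃ S₃ : ℕ, ∀ S : ℕ, S₃ ≤ S → ColdPressureBound r.ρ β S (c * Real.sqrt s) C₀ :=
  ratioStrongCoupling_specialUnitary G r hSU hN2

/-! ## §2 Composition: the crux `IR` BY NAME -/

/-- **Composition (kernel-checked; the only sorries are the four registered stubs it names):**
`stub_tensionFloor ∧ stub_ratioFloor ∧ stub_irCentreFree ∧ stub_irNSC ⇒` crux `IR` BY NAME, via the landed `ir_of_tension_ratio`. -/
theorem IR_of : Summit.QuantumFields.YangMills.Theses.BalabanLadder.IR :=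
  ir_of_tension_ratio stub_tensionFloor stub_ratioFloor stub_irCentreFree stub_irNSC

end Summit.QuantumFields.YangMills.Cruxes.IR.TensionRatio

end
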